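import Literature.Analysis.PDE.EvansKrylovJets
import Literature.Analysis.PDE.WeakHarnack
import Mathlib.Analysis.Calculus.MeanValue
import HarnessLib

/-!
# Evans–Krylov: the coupling of the pure second derivatives (Gilbarg–Trudinger §17.4)

The "coupling step" in the proof of Gilbarg–Trudinger's interior `C^{2,α}` estimate for concave
fully nonlinear equations (Thm. 17.14), in the coordinate-jet language of
`Literature/Analysis/PDE/EvansKrylovJets.lean` (the equation is `F(y, θ, cjet₂ u(y)) = 0`).
Everything here is proved.

* `coupling_bound` — the display "`F_{ij}(y, …)(D_{ij}u(y) − D_{ij}u(x)) ≤ … ≤ D₀|x − y|`" on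
  p. 461 of the 2001 printing (before (17.51)): concavity of `F` in the top slot (as a supporting
  hyperplane inequality between the jet of `u` at `y` and the hybrid jet carrying `D²u(x)`), the
  equation at `x` and at `y`, and the mean value inequality for `F` along the segment joining the
  jet at `x` to the hybrid jet give `DF(jet_y)[(0, 0, topJet(D²u(y) − D²u(x)))] ≤ D₀ |x − y|` with
  `D₀ = μ (1 + K)` (`μ` a bound for `DF`, `K` a bound for the derivatives of `u` of order `≤ 2`).
* `sum_mul_quadHess_sub_eq_fderiv` — the Motzkin–Wasow reading
  "`F_{ij}(D_{ij}u(y) − D_{ij}u(x)) = Σ β_k (D_{γ_kγ_k}u(y) − D_{γ_kγ_k}u(x))`": if the symbol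
  matrix is `Σ_k β_k γ_k ⊗ γ_k`, the top-slot derivative in the direction `D²u(y) − D²u(x)` is
  `Σ_k β_k (D_{γ_kγ_k}u(y) − D_{γ_kγ_k}u(x))` (symmetry of the Hessians, `fderiv_topJet_eq_pair`).
* helpers: `pair` is additive in its first argument (`pair_add_left`, `pair_sum_left`,
  `pair_vecMulVec_left`; homogeneity is `KrylovSafonov.pair_smul_left`), `topJet_neg`,
  `fderiv_topJet_sub_comm`, the symmetry of the top slot of the `2`-jet of a `C²` function
  (`cjetOf_last_comm`) and the Lipschitz bound for the derivatives of orders `< 2` on a ball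
  where the derivatives of orders `≤ 2` are bounded (`norm_iteratedFDeriv_sub_le_of_closedBall`).

## References

* D. Gilbarg, N. S. Trudinger, *Elliptic Partial Differential Equations of Second Order* (2001),
  §17.4, proof of Theorem 17.14, the displays between (17.50) and (17.51). [GilbargTrudinger2001]
-/

noncomputable section

open Matrix Finset Metric Set
open scoped Topology

namespace Literature.Analysis.PDE.EvansKrylov

open Literature.Analysis.Calculus Literature.Analysis.PDE.ABP Literature.Analysis.PDE.KrylovSafonov

variable {ι : Type*} [Fintype ι] [DecidableEq ι]

/-! ### Linearity of `pair` in the coefficient matrix -/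

omit [DecidableEq ι] in
/-- `pair` is additive in the coefficient matrix. [folklore] -/
theorem pair_add_left (a b H : Matrix ι ι ℝ) : pair (a + b) H = pair a H + pair b H := by
  simp only [pair, Matrix.add_apply, add_mul, Finset.sum_add_distrib]

omit [DecidableEq ι] in
/-- `pair` commutes with finite sums in the coefficient matrix. [folklore] -/
theorem pair_sum_left {κ : Type*} (s : Finset κ) (a : κ → Matrix ι ι ℝ) (H : Matrix ι ι ℝ) :
    pair (∑ k ∈ s, a k) H = ∑ k ∈ s, pair (a k) H := by
  classical
  induction s using Finset.induction_on with
  | empty => simp [pair]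
  | insert k s hk ih => rw [Finset.sum_insert hk, Finset.sum_insert hk, pair_add_left, ih]

omit [DecidableEq ι] in
/-- Pairing a dyad of coefficients: `Σ p_i q_j H_{ij} = p ⬝ (H q)`. [folklore] -/
theorem pair_vecMulVec_left (p q : ι → ℝ) (H : Matrix ι ι ℝ) :
    pair (vecMulVec p q) H = p ⬝ᵥ (H *ᵥ q) := by
  simp only [pair, vecMulVec_apply, dotProduct, mulVec, Finset.mul_sum]
  exact Finset.sum_congr rfl fun i _ ↦ Finset.sum_congr rfl fun j _ ↦ by ring

/-! ### Top-slot jets: negation, symmetry of the top slot of `cjet₂ u` -/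

omit [Fintype ι] [DecidableEq ι] in
/-- `topJet` respects negation. [folklore] -/
@[simp] theorem topJet_neg (Ω : (Fin 2 → ι) → ℝ) : topJet (-Ω) = -topJet Ω := by
  unfold topJet
  exact Pi.single_neg _ _

omit [Fintype ι] [DecidableEq ι] in
/-- The top-slot derivative is odd in the difference of the entries:
`DF(z)[(0, 0, topJet (Ω' − Ω))] = −DF(z)[(0, 0, topJet (Ω − Ω'))]`. [folklore] -/
theorem fderiv_topJet_sub_comm {P : Type*} [NormedAddCommGroup P] [NormedSpace ℝ P]
    (F : EuclideanSpace ℝ ι × P × CJet ι 2 → ℝ) (z : EuclideanSpace ℝ ι × P × CJet ι 2)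
    (Ω Ω' : (Fin 2 → ι) → ℝ) :
    fderiv ℝ F z ((0 : EuclideanSpace ℝ ι), (0 : P), topJet (Ω' - Ω)) =
      -fderiv ℝ F z ((0 : EuclideanSpace ℝ ι), (0 : P), topJet (Ω - Ω')) := by
  rw [← map_neg, Prod.neg_mk, Prod.neg_mk, neg_zero, neg_zero, ← topJet_neg, neg_sub]

/-- The top slot of the `2`-jet of a function twice continuously differentiable at the point is
symmetric (symmetry of second derivatives). [folklore] -/
theorem cjetOf_last_comm {u : EuclideanSpace ℝ ι → ℝ} {y : EuclideanSpace ℝ ι}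
    (hu : ContDiffAt ℝ 2 u y) (i j : ι) :
    cjetOf (EuclideanSpace.basisFun ι ℝ) 2 u y (Fin.last 2) ![i, j] =
      cjetOf (EuclideanSpace.basisFun ι ℝ) 2 u y (Fin.last 2) ![j, i] := by
  rw [← hessianMatrix_eq_cjetOf, ← hessianMatrix_eq_cjetOf, hessianMatrix_apply,
    hessianMatrix_apply]
  exact hu.isSymmSndFDerivAt (by simp) _ _

/-! ### Lipschitz bounds for the lower-order derivatives on a ball -/

/-- On a closed ball inside an open set on which `u` is `C²` with `‖Dᵐu‖ ≤ K` for `m ≤ 2`, the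
derivatives of orders `j < 2` are `K`-Lipschitz (mean value inequality on the convex ball).
[folklore] -/
theorem norm_iteratedFDeriv_sub_le_of_closedBall {E : Type*} [NormedAddCommGroup E]
    [NormedSpace ℝ E] {O : Set E} (hO : IsOpen O) {u : E → ℝ} (hu : ContDiffOn ℝ 2 u O)
    {y₀ : E} {R₀ K : ℝ} (hBO : closedBall y₀ R₀ ⊆ O)
    (hbd : ∀ y ∈ closedBall y₀ R₀, ∀ m ≤ 2, ‖iteratedFDeriv ℝ m u y‖ ≤ K) {j : ℕ} (hj : j < 2)
    {x y : E} (hx : x ∈ closedBall y₀ R₀) (hy : y ∈ closedBall y₀ R₀) :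
    ‖iteratedFDeriv ℝ j u y - iteratedFDeriv ℝ j u x‖ ≤ K * ‖y - x‖ := by
  refine (convex_closedBall y₀ R₀).norm_image_sub_le_of_norm_fderiv_le (𝕜 := ℝ)
    (f := iteratedFDeriv ℝ j u) (fun z hz ↦ ?_) (fun z hz ↦ ?_) hx hy
  · exact (hu.contDiffAt (hO.mem_nhds (hBO hz))).differentiableAt_iteratedFDeriv
      (by exact_mod_cast hj)
  · rw [norm_fderiv_iteratedFDeriv]
    exact hbd z hz (j + 1) hj

/-! ### The coupling bound -/

/-- **The coupling bound** (Gilbarg–Trudinger, proof of Thm. 17.14, "`≤ D₀|x − y|`" on p. 461 of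
the 2001 printing / the display before (17.51)): a constant `D₀ ≥ 0` depending only on `μ, K` such
that for a `C²` function `u` solving `F(y, θ, cjet₂u(y)) = 0` on a closed ball on which its
derivatives of orders `≤ 2` are bounded by `K`, `F ∈ C¹` with `‖DF(z, θ, J)‖ ≤ μ` for `z` in the
ball and `‖J‖ ≤ K`, and the supporting-hyperplane inequality (concavity of `F` in the top slot)
between the jet of `u` at `y` and the hybrid jet carrying the second derivatives of `u` at `x`
(for `|x − y| ≤ δ₀`), one has
`DF(jet_y)[(0, 0, topJet(D²u(y) − D²u(x)))] ≤ D₀ |x − y|` (mean value inequality along the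
segment from the jet at `x` to the hybrid jet, whose points have jets of norm `≤ K`).
[cite: GilbargTrudinger2001, §17.4, proof of Thm. 17.14] -/
theorem coupling_bound (ι : Type*) [Fintype ι] [DecidableEq ι]
    (P : Type*) [NormedAddCommGroup P] [NormedSpace ℝ P] {μ K : ℝ} (hμ : 0 ≤ μ) (hK : 0 ≤ K) :
    ∃ D₀ : ℝ, 0 ≤ D₀ ∧
      ∀ {O : Set (EuclideanSpace ℝ ι)}, IsOpen O →
      ∀ {u : EuclideanSpace ℝ ι → ℝ}, ContDiffOn ℝ 2 u O →
      ∀ {F : EuclideanSpace ℝ ι × P × CJet ι 2 → ℝ} {θ : P}, ContDiffOn ℝ 1 F {x | x.1 ∈ O} →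
      ∀ {y₀ : EuclideanSpace ℝ ι} {R₀ : ℝ}, closedBall y₀ R₀ ⊆ O →
        (∀ y ∈ closedBall y₀ R₀, F (y, θ, cjetOf (EuclideanSpace.basisFun ι ℝ) 2 u y) = 0) →
        (∀ y ∈ closedBall y₀ R₀, ∀ m ≤ 2, ‖iteratedFDeriv ℝ m u y‖ ≤ K) →
        (∀ z ∈ closedBall y₀ R₀, ∀ J : CJet ι 2, ‖J‖ ≤ K → ‖fderiv ℝ F (z, θ, J)‖ ≤ μ) →
      ∀ {δ₀ : ℝ},
        (∀ x ∈ closedBall y₀ R₀, ∀ y ∈ closedBall y₀ R₀, dist x y ≤ δ₀ →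
          F (y, θ, cjetOf (EuclideanSpace.basisFun ι ℝ) 2 u y +
              topJet (cjetOf (EuclideanSpace.basisFun ι ℝ) 2 u x (Fin.last 2) -
                cjetOf (EuclideanSpace.basisFun ι ℝ) 2 u y (Fin.last 2))) -
            F (y, θ, cjetOf (EuclideanSpace.basisFun ι ℝ) 2 u y) ≤
          fderiv ℝ F (y, θ, cjetOf (EuclideanSpace.basisFun ι ℝ) 2 u y)
            ((0 : EuclideanSpace ℝ ι), (0 : P),
              topJet (cjetOf (EuclideanSpace.basisFun ι ℝ) 2 u x (Fin.last 2) -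
                cjetOf (EuclideanSpace.basisFun ι ℝ) 2 u y (Fin.last 2)))) →
      ∀ x ∈ closedBall y₀ R₀, ∀ y ∈ closedBall y₀ R₀, dist x y ≤ δ₀ →
        fderiv ℝ F (y, θ, cjetOf (EuclideanSpace.basisFun ι ℝ) 2 u y)
          ((0 : EuclideanSpace ℝ ι), (0 : P),
            topJet (cjetOf (EuclideanSpace.basisFun ι ℝ) 2 u y (Fin.last 2) -
              cjetOf (EuclideanSpace.basisFun ι ℝ) 2 u x (Fin.last 2))) ≤ D₀ * dist x y := by
  refine ⟨μ * (1 + K), mul_nonneg hμ (by linarith), ?_⟩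
  intro O hO u hu F θ hF y₀ R₀ hBO hF0 hbd hDF δ₀ hsupp x hx y hy hxy
  have hsuppxy := hsupp x hx y hy hxy
  have hFx := hF0 x hx
  have hFy := hF0 y hy
  set Jx := cjetOf (EuclideanSpace.basisFun ι ℝ) 2 u x with hJx
  set Jy := cjetOf (EuclideanSpace.basisFun ι ℝ) 2 u y with hJy
  set hyb : CJet ι 2 := Jy + topJet (Jx (Fin.last 2) - Jy (Fin.last 2)) with hhyb
  set p : EuclideanSpace ℝ ι × P × CJet ι 2 := (x, θ, Jx) with hp
  set q : EuclideanSpace ℝ ι × P × CJet ι 2 := (y, θ, hyb) with hq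
  -- the jets at `x`, `y` and the hybrid jet have norm `≤ K`
  have hJx_le : ‖Jx‖ ≤ K := norm_cjetOf_le _ 2 u x (hbd x hx) hK
  have hJy_le : ‖Jy‖ ≤ K := norm_cjetOf_le _ 2 u y (hbd y hy) hK
  have hhyb_le : ‖hyb‖ ≤ K := by
    refine (pi_norm_le_iff_of_nonneg hK).2 fun j ↦ ?_
    by_cases hj : j = Fin.last 2
    · subst hj
      rw [hhyb, Pi.add_apply, topJet_apply_last, add_sub_cancel]
      exact (norm_le_pi_norm Jx _).trans hJx_le
    · rw [hhyb, Pi.add_apply, topJet_apply_of_ne _ hj, add_zero]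
      exact (norm_le_pi_norm Jy _).trans hJy_le
  -- points of the segment `[p, q]`: first component in the ball, second `θ`, jet of norm `≤ K`
  have hseg : ∀ z ∈ segment ℝ p q, z.1 ∈ closedBall y₀ R₀ ∧ z.2.1 = θ ∧ ‖z.2.2‖ ≤ K := by
    rintro z ⟨a, b, ha, hb, hab, rfl⟩
    refine ⟨?_, ?_, ?_⟩
    · show a • x + b • y ∈ closedBall y₀ R₀
      exact convex_closedBall y₀ R₀ hx hy ha hb hab
    · show a • θ + b • θ = θ
      rw [← add_smul, hab, one_smul]
    · show ‖a • Jx + b • hyb‖ ≤ K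
      calc ‖a • Jx + b • hyb‖ ≤ ‖a • Jx‖ + ‖b • hyb‖ := norm_add_le _ _
        _ = a * ‖Jx‖ + b * ‖hyb‖ := by
          rw [norm_smul, norm_smul, Real.norm_of_nonneg ha, Real.norm_of_nonneg hb]
        _ ≤ a * K + b * K := by gcongr
        _ = K := by rw [← add_mul, hab, one_mul]
  -- (c) the mean value inequality for `F` on the segment
  have hMV : ‖F q - F p‖ ≤ μ * ‖q - p‖ := by
    refine (convex_segment p q).norm_image_sub_le_of_norm_fderiv_le (𝕜 := ℝ) (f := F)
      (fun z hz ↦ ?_) (fun z hz ↦ ?_) (left_mem_segment ℝ p q) (right_mem_segment ℝ p q)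
    · obtain ⟨hz1, -, -⟩ := hseg z hz
      exact (hF.contDiffAt ((hO.preimage continuous_fst).mem_nhds (hBO hz1))).differentiableAt
        one_ne_zero
    · obtain ⟨hz1, hz2, hz3⟩ := hseg z hz
      obtain ⟨z1, z2, z3⟩ := z
      subst hz2
      exact hDF z1 hz1 z3 hz3
  -- (d) the length of the segment
  have hdist : ‖q - p‖ ≤ (1 + K) * dist x y := by
    have hd0 : 0 ≤ dist x y := dist_nonneg
    have h1 : ‖y - x‖ ≤ (1 + K) * dist x y := by
      rw [← dist_eq_norm, dist_comm]; nlinarith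
    have h3 : ‖hyb - Jx‖ ≤ K * dist x y := by
      refine (pi_norm_le_iff_of_nonneg (by positivity)).2 fun j ↦ ?_
      by_cases hj : j = Fin.last 2
      · subst hj
        rw [Pi.sub_apply, hhyb, Pi.add_apply, topJet_apply_last, add_sub_cancel, sub_self,
          norm_zero]
        positivity
      · rw [Pi.sub_apply, hhyb, Pi.add_apply, topJet_apply_of_ne _ hj, add_zero]
        refine (pi_norm_le_iff_of_nonneg (by positivity)).2 fun I ↦ ?_
        rw [Pi.sub_apply, hJy, hJx, cjetOf_apply, cjetOf_apply,
          ← _root_.sub_apply]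
        refine (ContinuousMultilinearMap.le_opNorm _ _).trans ?_
        rw [Finset.prod_eq_one (fun k _ ↦ (EuclideanSpace.basisFun ι ℝ).orthonormal.1 (I k)),
          mul_one, dist_comm, dist_eq_norm]
        exact norm_iteratedFDeriv_sub_le_of_closedBall hO hu hBO hbd
          (lt_of_le_of_ne (Nat.lt_succ_iff.1 j.isLt) fun h ↦ hj (Fin.ext h)) hx hy
    rw [hq, hp, Prod.mk_sub_mk, Prod.mk_sub_mk, sub_self, Prod.norm_mk, Prod.norm_mk, norm_zero]
    refine max_le h1 (max_le (by positivity) (h3.trans ?_))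
    nlinarith
  -- (a) linearity and (b) the supporting hyperplane inequality + the equation at `x` and `y`
  calc fderiv ℝ F (y, θ, Jy)
        ((0 : EuclideanSpace ℝ ι), (0 : P), topJet (Jy (Fin.last 2) - Jx (Fin.last 2)))
      = -fderiv ℝ F (y, θ, Jy)
          ((0 : EuclideanSpace ℝ ι), (0 : P), topJet (Jx (Fin.last 2) - Jy (Fin.last 2))) :=
        fderiv_topJet_sub_comm F _ _ _
    _ ≤ F p - F q := by
        have hFp : F p = 0 := hFx
        have hFq : F q - F (y, θ, Jy) ≤ fderiv ℝ F (y, θ, Jy)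
            ((0 : EuclideanSpace ℝ ι), (0 : P), topJet (Jx (Fin.last 2) - Jy (Fin.last 2))) :=
          hsuppxy
        rw [hFy] at hFq
        linarith
    _ ≤ ‖F q - F p‖ := by
        rw [Real.norm_eq_abs, abs_sub_comm]; exact le_abs_self _
    _ ≤ μ * ‖q - p‖ := hMV
    _ ≤ μ * ((1 + K) * dist x y) := by gcongr
    _ = μ * (1 + K) * dist x y := by ring

/-! ### The Motzkin–Wasow reading of the top-slot derivative -/

/-- **Motzkin–Wasow reading of the top-slot derivative** (Gilbarg–Trudinger §17.4, the display
"`F_{ij}(D_{ij}u(y) − D_{ij}u(x)) = Σ β_k (D_{γ_kγ_k}u(y) − D_{γ_kγ_k}u(x))`"): if the symbol matrix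
at the jet of `u` at `y` is `Σ_k β_k γ_k ⊗ γ_k`, then
`Σ_k β_k (D_{γ_kγ_k}u(y) − D_{γ_kγ_k}u(x)) = DF(jet_y)[(0, 0, topJet(D²u(y) − D²u(x)))]`
(for `u` twice continuously differentiable at `x` and `y`, so that the Hessians are symmetric).
[cite: GilbargTrudinger2001, §17.4, proof of Thm. 17.14] -/
theorem sum_mul_quadHess_sub_eq_fderiv {ι : Type*} [Fintype ι] [DecidableEq ι]
    {P : Type*} [NormedAddCommGroup P] [NormedSpace ℝ P]
    {F : EuclideanSpace ℝ ι × P × CJet ι 2 → ℝ} {θ : P} {u : EuclideanSpace ℝ ι → ℝ}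
    {x y : EuclideanSpace ℝ ι} (hux : ContDiffAt ℝ 2 u x) (huy : ContDiffAt ℝ 2 u y)
    {Kt : Type*} [Fintype Kt] {γ : Kt → ι → ℝ} {β : Kt → ℝ}
    (hβ : symbolMatrix F (y, θ, cjetOf (EuclideanSpace.basisFun ι ℝ) 2 u y) =
      ∑ k, β k • vecMulVec (γ k) (γ k)) :
    ∑ k, β k * (quadHess u (γ k) y - quadHess u (γ k) x) =
      fderiv ℝ F (y, θ, cjetOf (EuclideanSpace.basisFun ι ℝ) 2 u y)
        ((0 : EuclideanSpace ℝ ι), (0 : P),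
          topJet (cjetOf (EuclideanSpace.basisFun ι ℝ) 2 u y (Fin.last 2) -
            cjetOf (EuclideanSpace.basisFun ι ℝ) 2 u x (Fin.last 2))) := by
  have hΩ : ∀ i j, (cjetOf (EuclideanSpace.basisFun ι ℝ) 2 u y (Fin.last 2) -
      cjetOf (EuclideanSpace.basisFun ι ℝ) 2 u x (Fin.last 2)) ![i, j] =
      (cjetOf (EuclideanSpace.basisFun ι ℝ) 2 u y (Fin.last 2) -
        cjetOf (EuclideanSpace.basisFun ι ℝ) 2 u x (Fin.last 2)) ![j, i] := fun i j ↦ by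
    rw [Pi.sub_apply, Pi.sub_apply, cjetOf_last_comm huy i j, cjetOf_last_comm hux i j]
  have hH : hessianMatrix u (EuclideanSpace.basisFun ι ℝ) y -
      hessianMatrix u (EuclideanSpace.basisFun ι ℝ) x =
      Matrix.of fun i j ↦ (cjetOf (EuclideanSpace.basisFun ι ℝ) 2 u y (Fin.last 2) -
        cjetOf (EuclideanSpace.basisFun ι ℝ) 2 u x (Fin.last 2)) ![i, j] := by
    ext i j
    rw [Matrix.sub_apply, Matrix.of_apply, Pi.sub_apply, hessianMatrix_eq_cjetOf,
      hessianMatrix_eq_cjetOf]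
  rw [fderiv_topJet_eq_pair F _ hΩ, hβ, pair_sum_left]
  refine Finset.sum_congr rfl fun k _ ↦ ?_
  rw [pair_smul_left, pair_vecMulVec_left, quadHess_eq, quadHess_eq, ← dotProduct_sub,
    ← sub_mulVec, hH]

end Literature.Analysis.PDE.EvansKrylov

end
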